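/-
Copyright: lit-balaban cell, Phase-2 proof seat p24 (gen 25).  Released under Apache 2.0 license as described in the
file LICENSE.
-/
import Literature.MathematicalPhysics.QuantumFieldTheory.Balaban1983to89.B4Thm110ZeroLattice
import Literature.Analysis.FunctionSpaces.RieszThorinKernel

/-!
# `Balaban1983to89.B4Lemma22ZeroLattice` — [Balaban1983RegularityDecay] Lemma 2.2 p. 577–578: the diagonal `q = p ∈ [1,∞]`
# of (2.17) FOR `□ ↦` THE WHOLE LATTICE `ηℤ^{d+1}`, `A = 0`, every dimension — the `ℓ^p → ℓ^p` bounds of the infinite-volume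
# propagator `G_k(0)` (`B3GkZeroLattice.GkLat`) and of the (2.46)-propagator `G246`, from `B4Thm110ZeroLattice` (row and column
# sums) and the Riesz–Thorin ∕ Schur bound `RieszThorinKernel.schur_riesz_thorin_counting` («The Riesz-Thorin Theorem implies
# it for arbitrary q = p from [1, ∞]», p. 583); and (1.6): `G_k(0)` is the two-sided inverse of `D` on finitely supported fields

statement-level skeleton of published theorems with citation tags; proofs where landed; nothing here is a claim about
the Yang–Mills mass gap

CITATION HEADER.  T. Bałaban, *Regularity and decay of lattice Green's functions*, Commun. Math. Phys. **89** (1983)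
571–597, doi:10.1007/bf01214744 [Balaban1983RegularityDecay] (cell paper B4; held text
`paper:balaban1983-cmp89-regularity-decay`, journal page = PDF page + 570): p. 572 [PDF 2] (1.6), p. 577–578 [PDF 7–8]
Lemma 2.2 (2.16)–(2.17), p. 583 [PDF 13] the proof paragraph of (2.17), p. 584 [PDF 14] (2.44)–(2.46); [Balaban1983Higgs3]
p. 433 (the propagator `G_k(0)` on `ηℤ^{d+1}`).  Unit `lit-balaban-p24` gen 25; HOME `run/shared/lean/pub/lit-balaban/`; SKELETON
rows **B4.Lem2.2**, **B4.Eq1.6** and **B4.Eq2.43** (owner r01) — cells only, proved-headed.  Companion of `B4Thm110ZeroLattice`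
((1.10) value clause, the `ℓ²` bridge) and `B4Thm19ZeroLattice` ((1.9), the derivative clause of (1.10), (2.17) at the corners
`q = p = ∞` for `∂^η_μG_k(0)` and `q = p = 1` for `G_k(0)∂^{η*}_μ`); imports the former only.

WHAT IS PRINTED.  p. 577–578, Lemma 2.2: «Let a rectangular parallelepiped □ be a sum of few large blocks …, and let Ã be a
regular vector field configuration …. Then for e sufficiently small and α < 1, there exists a constant c₁ depending on d, α
only, such that ‖G_k(□,Ã)f‖_{1,α} ≦ c₁‖f‖_∞, (2.16) and a constant c₂ depending on d, p₁, such that ‖G_k(□,Ã)f‖_q,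
‖D^η_{Ã,μ}G_k(□,Ã)f‖_q, ‖G_k(□,Ã)D^{η*}_{Ã,μ}f‖_q ≦ c₂‖f‖_p (2.17) for 1 ≦ p, q ≦ ∞, satisfying the condition 1/p − 1/p₁ ≦ 1/q
≦ 1/p with p₁ > d.»  p. 583: «Now we will prove the inequality (2.17) for G_k(□). For q = p = ∞, it is a special case of (2.16)
… For q = p = 1 we get it by duality argument …. The Riesz-Thorin Theorem implies it for arbitrary q = p from [1, ∞].»  p. 584:
«This part of the argument is valid for an arbitrary rectangular parallelepiped □ built of unit blocks, so the inequalities are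
valid for all such sets.»  p. 572: «G_k(Ω, A) = (−Δ^{η,N}_{A,Ω} + m² + aP_k(A))^{−1}, (1.6)».

WHAT THIS MODULE PROVES (kernel-checked; theorems only; 0 `def`; 0 `sorry`; axioms standard), in the matrix units of the
zero-field lineage (`n = L^k`, running `a_k`, window `a ∈ [a₋,a₊]`, `m² ∈ [0,m²₊]`, `G_k(0) = GkLat`,
`(G_k(0)f)(x) = Σ_{x′}G_k(0)(x,x′)f(x′)`; the `η^{(d+1)/p}` of the `ℓ^p_η` norms cancel between the two sides of (2.17) when `q = p`):
* §1 **(2.17), `q = p ∈ [1,∞[`, FOR `G_k(0)` ON `ηℤ^{d+1}`**: `GkLat_apply_lp_le` — with `c₀` of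
  `B4Thm110ZeroLattice.GkLat_weightedRow_le` (row AND column sums `≤ c₀`, `GkLat_comm`), for every real `p ≥ 1`, every finite
  `S` (carrying the data) and finite output window `Λ`: `(Σ_{x∈Λ}|Σ_{x′∈S}G_k(0)(x,x′)f(x′)|^p)^{1/p} ≤ c₀(Σ_{x′∈S}|f(x′)|^p)^{1/p}`
  — `schur_riesz_thorin_counting` on the finite truncation `Λ × S` (its row/column sums are partial sums of the lattice ones);
  hence the series form `GkLat_apply_lp_tsum_le`: `Σ_x|(G_k(0)f)(x)|^p ≤ c₀^p Σ_{x′}|f(x′)|^p`, i.e. `‖G_k(0)f‖_p ≤ c₀‖f‖_p`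
  (`p = ∞`: `B4Thm110ZeroLattice.GkLat_apply_le`); and `G246_apply_lp_tsum_le`: the same for the (2.46)-propagator
  `G_j = G246 n a m²` of [B4] with the LITERAL coefficient `a ∈ [a₋,a₊]`, `m² > 0` (`G_jf = G_k(0)f`,
  `B4Thm110ZeroLattice.GkLat_apply_eq_G246`, `a = (a/c_k)_k`).
* §2 **(1.6), TWO-SIDED**: `GkLat_apply_opD_eq` — `G_k(0)(Dφ) = φ` for finitely supported `φ`, all `m² ≥ 0`; with
  `B4Thm110ZeroLattice.GkLat_apply_finsupp` (`D(G_k(0)f) = f`) the kernel `G_k(0)` is the two-sided inverse of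
  `D = −Δ^ξ + m² + a_kQ_k^*Q_k` on finitely supported fields (by `ℓ²`-uniqueness, `B4Ineq227LatticeL2.opD_injective_l2_of_pos`).
* §3 non-vacuity (`d + 1 = 4`, `L = 2`, `a ∈ [1/2,2]`, `m² ∈ [0,1]`).

DICTIONARY / HONEST SCOPE.  (i) `A = 0`, one component, `□ ↦ ηℤ^{d+1}` (p. 584's «valid for all such sets» read for the whole
lattice through the infinite-volume limit of the companion files); sup-norm distances; constants existential.  (ii) (2.17) only
on the diagonal `q = p` for `G_k(0)` itself (the three printed corners + Riesz–Thorin, exactly the p. 583 paragraph); the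
off-diagonal range `1/p − 1/p₁ ≤ 1/q < 1/p` (Sobolev-type gain, p. 583 «bounded operators from L¹ to L^{p′₁}») is NOT in this
file — it is the sibling `B4Lemma22ZeroLatticeLpLq` (η-weighted norms, all three operators, from the box form
`B4Lemma22ZeroBoxLpLq`); the derivative operators here only at the corners given in `B4Thm19ZeroLattice`
(the lineage bounds the rows of the differenced kernel, not its columns); (2.16) on the lattice = the `D = 0` instances of
`GkLat_apply_le` ∕ `GkLatD_apply_le` ∕ `GkLatH_apply_le` of the two companion files, not re-packaged here.  (iii) `ℓ^p` statements
are on finitely supported data ∕ finite output windows plus the series form (no `lp`-space packaging).  (iv) Value = Lemma 2.2's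
diagonal (2.17) and the two-sided (1.6) for the free infinite-lattice propagator; cells only; NOT summit progress.
-/

namespace Literature.MathematicalPhysics.QuantumFieldTheory.Balaban1983to89.B4Lemma22ZeroLattice

open Finset Filter Topology Complex
open Literature.MathematicalPhysics.QuantumFieldTheory.Balaban1983to89.B4ContourShift (supNorm supNorm_nonneg)
open Literature.MathematicalPhysics.QuantumFieldTheory.Balaban1983to89.B3GkZeroLattice (GkLat GkLat_comm)
open Literature.MathematicalPhysics.QuantumFieldTheory.Balaban1983to89.B4Thm110ZeroLattice
open Literature.Analysis.FunctionSpaces.RieszThorin (schur_riesz_thorin_counting)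
open Literature.MathematicalPhysics.QuantumFieldTheory.Balaban1983to89.B4Thm110ZeroBox (Linv_sq_bounds cK cK_pos cK_le_one
  oneSub_le_cK aSeq_div_cK)
open Literature.MathematicalPhysics.QuantumFieldTheory.Balaban1983to89.B4Eq246SolvesEq244 (G246)
open Literature.MathematicalPhysics.QuantumFieldTheory.Balaban1983to89.B4Green244 (opD)
open Literature.MathematicalPhysics.QuantumFieldTheory.Balaban1983to89.B4Ineq227LatticeL2 (opD_injective_l2_of_pos)
open Literature.MathematicalPhysics.QuantumFieldTheory.Balaban1983to89.B4Thm110ZeroBox (one_lt_L_real)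

noncomputable section

variable {d : ℕ}

/-! ## §0 Kernel helpers -/

/-- kernel: a plain finite row sum is dominated by the exponentially weighted one (non-negative exponent). [folklore] -/
private theorem sum_abs_le_of_weighted {K w : (Fin (d + 1) → ℤ) → ℝ} {c₀ : ℝ} (hw : ∀ z, 0 ≤ w z)
    (hF : ∀ F : Finset (Fin (d + 1) → ℤ), ∑ z ∈ F, |K z| * Real.exp (w z) ≤ c₀) (F : Finset (Fin (d + 1) → ℤ)) :
    ∑ z ∈ F, |K z| ≤ c₀ :=
  (Finset.sum_le_sum fun z _ => le_mul_of_one_le_right (abs_nonneg _) (Real.one_le_exp (hw z))).trans (hF F)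

/-- kernel: the weight exponent of the lineage is non-negative. [folklore] -/
private theorem weight_nonneg {δ₀ : ℝ} (hδ₀ : 0 ≤ δ₀) (n : ℕ) (u : Fin (d + 1) → ℤ) :
    0 ≤ δ₀ * supNorm u / (n : ℝ) :=
  div_nonneg (mul_nonneg hδ₀ (supNorm_nonneg _)) (Nat.cast_nonneg _)

/-! ## §1 (2.17), `q = p ∈ [1,∞[`, for `G_k(0)` on `ηℤ^{d+1}` -/

/-- **LEMMA 2.2 (2.17) ON THE DIAGONAL `q = p ∈ [1,∞[` FOR `G_k(0)`, `□ ↦ ηℤ^{d+1}`, `A = 0`** (finite truncations): with the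
constant `c₀` of `B4Thm110ZeroLattice.GkLat_weightedRow_le` — so that all row sums AND (by `GkLat_comm`) all column sums of
`|G_k(0)(x,x′)|` are `≤ c₀` —, for every real `p ≥ 1`, every finite `S` (support of the data) and `Λ` (output window) and
every `f`: `(Σ_{x∈Λ}|Σ_{x′∈S}G_k(0)(x,x′)f(x′)|^p)^{1/p} ≤ c₀·(Σ_{x′∈S}|f(x′)|^p)^{1/p}` — «For q = p = ∞ … (2.16) … For q = p = 1
… by duality … The Riesz-Thorin Theorem implies it for arbitrary q = p from [1, ∞]» (`schur_riesz_thorin_counting` on `Λ × S`,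
constant `c₀^{1−1/p}c₀^{1/p} = c₀`). [cite: Balaban1983RegularityDecay, Lemma 2.2 (2.17) p.578; proof p.583; dictionary (□ ↦ ηℤ^{d+1}, A = 0)] -/
theorem GkLat_apply_lp_le (d ℓ : ℕ) (hℓ : 1 ≤ ℓ) (amin aplus m2plus : ℝ) (ha : 0 < amin) :
    ∃ c₀ : ℝ, 0 < c₀ ∧ ∀ (k : ℕ), 1 ≤ k → ∀ (a m2 : ℝ), amin ≤ a → a ≤ aplus → 0 ≤ m2 → m2 ≤ m2plus →
      ∀ (p : ℝ), 1 ≤ p → ∀ (S Λ : Finset (Fin (d + 1) → ℤ)) (f : (Fin (d + 1) → ℤ) → ℂ),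
        (∑ x ∈ Λ, ‖∑ x' ∈ S, ((GkLat ℓ k a m2 x x' : ℝ) : ℂ) * f x'‖ ^ p) ^ p⁻¹
          ≤ c₀ * (∑ x' ∈ S, ‖f x'‖ ^ p) ^ p⁻¹ := by
  classical
  obtain ⟨δ₀, c₀, hδ₀, hc₀, h⟩ := GkLat_weightedRow_le d ℓ hℓ amin aplus m2plus ha
  refine ⟨c₀, hc₀, ?_⟩
  intro k hk a m2 h1 h2 h3 h4 p hp S Λ f
  have hrowF : ∀ (x : Fin (d + 1) → ℤ) (F : Finset (Fin (d + 1) → ℤ)), ∑ x' ∈ F, |GkLat ℓ k a m2 x x'| ≤ c₀ :=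
    fun x F => sum_abs_le_of_weighted (fun z => weight_nonneg hδ₀.le _ (x - z)) (h k hk a m2 h1 h2 h3 h4 x) F
  -- the truncated kernel on `Λ × S`
  set K : ↥Λ → ↥S → ℂ := fun x x' => ((GkLat ℓ k a m2 x.1 x'.1 : ℝ) : ℂ) with hK
  have hrow : ∀ x : ↥Λ, ∑ x' : ↥S, ‖K x x'‖ ≤ c₀ := by
    intro x
    have := hrowF x.1 S
    rw [← Finset.sum_coe_sort S] at this
    simpa only [hK, Complex.norm_real, Real.norm_eq_abs] using this
  have hcol : ∀ x' : ↥S, ∑ x : ↥Λ, ‖K x x'‖ ≤ c₀ := by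
    intro x'
    have := hrowF x'.1 Λ
    rw [← Finset.sum_coe_sort Λ] at this
    simp only [hK, Complex.norm_real, Real.norm_eq_abs]
    refine le_of_eq_of_le (Finset.sum_congr rfl fun x _ => ?_) this
    rw [GkLat_comm]
  have H := schur_riesz_thorin_counting hc₀.le hc₀.le hrow hcol hp (fun x' : ↥S => f x'.1)
  have hp0 : 0 < p := by linarith
  have hcc : c₀ ^ (1 - p⁻¹) * c₀ ^ p⁻¹ = c₀ := by
    rw [← Real.rpow_add hc₀, sub_add_cancel, Real.rpow_one]
  rw [hcc] at H
  have hL : (∑ x : ↥Λ, ‖∑ x' : ↥S, K x x' * f x'.1‖ ^ p)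
      = ∑ x ∈ Λ, ‖∑ x' ∈ S, ((GkLat ℓ k a m2 x x' : ℝ) : ℂ) * f x'‖ ^ p := by
    rw [← Finset.sum_coe_sort Λ]
    refine Finset.sum_congr rfl fun x _ => ?_
    rw [← Finset.sum_coe_sort S]
  have hR : (∑ x' : ↥S, ‖f x'.1‖ ^ p) = ∑ x' ∈ S, ‖f x'‖ ^ p := by
    rw [← Finset.sum_coe_sort S]
  rw [hL, hR] at H
  exact H

/-- **(2.17), `q = p`, SERIES FORM**: `Σ_{x∈ℤ^{d+1}}|(G_k(0)f)(x)|^p ≤ c₀^p·Σ_{x′}|f(x′)|^p` for finitely supported `f` — i.e.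
`‖G_k(0)f‖_{ℓ^p} ≤ c₀‖f‖_{ℓ^p}`, `1 ≤ p < ∞` (the finite-window bound of `GkLat_apply_lp_le` for every window).
[cite: Balaban1983RegularityDecay, Lemma 2.2 (2.17) p.578; proof p.583; dictionary (□ ↦ ηℤ^{d+1}, A = 0)] -/
theorem GkLat_apply_lp_tsum_le (d ℓ : ℕ) (hℓ : 1 ≤ ℓ) (amin aplus m2plus : ℝ) (ha : 0 < amin) :
    ∃ c₀ : ℝ, 0 < c₀ ∧ ∀ (k : ℕ), 1 ≤ k → ∀ (a m2 : ℝ), amin ≤ a → a ≤ aplus → 0 ≤ m2 → m2 ≤ m2plus →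
      ∀ (p : ℝ), 1 ≤ p → ∀ (S : Finset (Fin (d + 1) → ℤ)) (f : (Fin (d + 1) → ℤ) → ℂ),
        (Summable fun x => ‖∑ x' ∈ S, ((GkLat ℓ k a m2 x x' : ℝ) : ℂ) * f x'‖ ^ p) ∧
        ∑' x, ‖∑ x' ∈ S, ((GkLat ℓ k a m2 x x' : ℝ) : ℂ) * f x'‖ ^ p ≤ c₀ ^ p * ∑ x' ∈ S, ‖f x'‖ ^ p := by
  obtain ⟨c₀, hc₀, h⟩ := GkLat_apply_lp_le d ℓ hℓ amin aplus m2plus ha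
  refine ⟨c₀, hc₀, ?_⟩
  intro k hk a m2 h1 h2 h3 h4 p hp S f
  have hp0 : 0 < p := by linarith
  set B : ℝ := ∑ x' ∈ S, ‖f x'‖ ^ p with hB
  have hB0 : 0 ≤ B := Finset.sum_nonneg fun _ _ => Real.rpow_nonneg (norm_nonneg _) _
  have hwin : ∀ Λ : Finset (Fin (d + 1) → ℤ),
      ∑ x ∈ Λ, ‖∑ x' ∈ S, ((GkLat ℓ k a m2 x x' : ℝ) : ℂ) * f x'‖ ^ p ≤ c₀ ^ p * B := by
    intro Λ
    set A : ℝ := ∑ x ∈ Λ, ‖∑ x' ∈ S, ((GkLat ℓ k a m2 x x' : ℝ) : ℂ) * f x'‖ ^ p with hA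
    have hA0 : 0 ≤ A := Finset.sum_nonneg fun _ _ => Real.rpow_nonneg (norm_nonneg _) _
    have h1 : A ^ p⁻¹ ≤ c₀ * B ^ p⁻¹ := h k hk a m2 h1 h2 h3 h4 p hp S Λ f
    have h2 := Real.rpow_le_rpow (Real.rpow_nonneg hA0 _) h1 hp0.le
    rw [Real.rpow_inv_rpow hA0 hp0.ne', Real.mul_rpow hc₀.le (Real.rpow_nonneg hB0 _),
      Real.rpow_inv_rpow hB0 hp0.ne'] at h2
    exact h2
  exact ⟨summable_of_sum_le (fun _ => Real.rpow_nonneg (norm_nonneg _) _) hwin,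
    Real.tsum_le_of_sum_le (fun _ => Real.rpow_nonneg (norm_nonneg _) _) hwin⟩

/-- **(2.17), `q = p ∈ [1,∞[`, FOR THE (2.46)-PROPAGATOR `G_j` OF [B4] WITH THE LITERAL COEFFICIENT `a` OF (1.6)**: there is
`c₀ > 0` (on `d`, `L`, the window) such that for every `k ≥ 1`, `a ∈ [a₋,a₊]`, `m² ∈ ]0,m²₊]`, real `p ≥ 1` and finitely supported
`f` (support in `S`): `Σ_x|(G246 n a m² f)(x)|^p ≤ c₀^p Σ_{x′}|f(x′)|^p` — `‖G_jf‖_p ≤ c₀‖f‖_p`; `G_jf = G_k(0)f` by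
`B4Thm110ZeroLattice.GkLat_apply_eq_G246` at the running coefficient `(a/c_k)_k = a` (`B4Thm110ZeroBox.aSeq_div_cK`).
[cite: Balaban1983RegularityDecay, Lemma 2.2 (2.17) p.578; proof p.583; (2.44)–(2.46) p.584; dictionary (□ ↦ ξℤ^{d+1}, A = 0)] -/
theorem G246_apply_lp_tsum_le (d ℓ : ℕ) (hℓ : 1 ≤ ℓ) (amin aplus m2plus : ℝ) (ha : 0 < amin) :
    ∃ c₀ : ℝ, 0 < c₀ ∧ ∀ (k : ℕ), 1 ≤ k → ∀ (a m2 : ℝ), amin ≤ a → a ≤ aplus → 0 < m2 → m2 ≤ m2plus →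
      ∀ (p : ℝ), 1 ≤ p → ∀ (S : Finset (Fin (d + 1) → ℤ)) (f : (Fin (d + 1) → ℤ) → ℂ), (∀ z ∉ S, f z = 0) →
        (Summable fun x => ‖G246 ((ℓ + 1) ^ k) a m2 f x‖ ^ p) ∧
        ∑' x, ‖G246 ((ℓ + 1) ^ k) a m2 f x‖ ^ p ≤ c₀ ^ p * ∑ x' ∈ S, ‖f x'‖ ^ p := by
  obtain ⟨hr0, hr1⟩ := Linv_sq_bounds hℓ
  obtain ⟨c₀, hc₀, h⟩ := GkLat_apply_lp_tsum_le d ℓ hℓ amin (aplus / (1 - ((((ℓ : ℝ) + 1)) ^ 2)⁻¹)) m2plus ha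
  refine ⟨c₀, hc₀, ?_⟩
  intro k hk a m2 h1 h2 h3 h4 p hp S f hf
  have hc := cK_pos hℓ hk
  have hA1 : amin ≤ a / cK ℓ k := by
    rw [le_div_iff₀ hc]
    calc amin * cK ℓ k ≤ amin * 1 := mul_le_mul_of_nonneg_left (cK_le_one hℓ hk) ha.le
      _ ≤ a := by linarith
  have hA2 : a / cK ℓ k ≤ aplus / (1 - ((((ℓ : ℝ) + 1)) ^ 2)⁻¹) :=
    div_le_div₀ (by linarith) h2 (by linarith) (oneSub_le_cK hℓ hk)
  have hA0 : 0 < a / cK ℓ k := ha.trans_le hA1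
  have heq := GkLat_apply_eq_G246 hℓ hk hA0 h3 S hf
  rw [aSeq_div_cK hℓ hk] at heq
  have hpt : ∀ x, (∑ x' ∈ S, ((GkLat ℓ k (a / cK ℓ k) m2 x x' : ℝ) : ℂ) * f x') = G246 ((ℓ + 1) ^ k) a m2 f x :=
    fun x => congrFun heq x
  have H := h k hk (a / cK ℓ k) m2 hA1 hA2 h3.le h4 p hp S f
  simp_rw [hpt] at H
  exact H

/-! ## §2 `G_k(0)` is the two-sided inverse of `−Δ^ξ + m² + a_kQ_k^*Q_k` on finitely supported fields -/

/-- **`G_k(0)(Dφ) = φ` FOR FINITELY SUPPORTED `φ`** (all `m² ≥ 0`): together with `B4Thm110ZeroLattice.GkLat_apply_finsupp`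
(`D(G_k(0)f) = f`) the kernel `G_k(0)` is the two-sided inverse of `D = −Δ^ξ + m² + a_kQ_k^*Q_k` on finitely supported fields —
«G_k(Ω,A) = (−Δ^{η,N}_{A,Ω} + m² + aP_k(A))^{−1} (1.6)» for `Ω = ηℤ^{d+1}`, `A = 0`; by `ℓ²`-uniqueness
(`B4Ineq227LatticeL2.opD_injective_l2_of_pos`): both sides are square-summable with the same image `Dφ`.  `S′` is any finite set
carrying the (finitely supported) field `Dφ`. [cite: Balaban1983RegularityDecay, (1.6) p.572, (2.44) p.584; dictionary (Ω = ηℤ^{d+1}, A = 0)] -/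
theorem GkLat_apply_opD_eq {ℓ k : ℕ} (hℓ : 1 ≤ ℓ) (hk : 1 ≤ k) {a m2 : ℝ} (ha : 0 < a) (hm : 0 ≤ m2)
    {φ : (Fin (d + 1) → ℤ) → ℂ} (S S' : Finset (Fin (d + 1) → ℤ)) (hφ : ∀ z ∉ S, φ z = 0)
    (hS' : ∀ z ∉ S', opD ((ℓ + 1) ^ k) (B1.aSeq a ((ℓ : ℝ) + 1) k) m2 φ z = 0) :
    (fun x => ∑ x' ∈ S', ((GkLat ℓ k a m2 x x' : ℝ) : ℂ) * opD ((ℓ + 1) ^ k) (B1.aSeq a ((ℓ : ℝ) + 1) k) m2 φ x') = φ := by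
  haveI : NeZero ((ℓ + 1) ^ k) := ⟨pow_ne_zero _ (Nat.succ_ne_zero ℓ)⟩
  have hak : 0 < B1.aSeq a ((ℓ : ℝ) + 1) k := B1.aSeq_pos ha (one_lt_L_real hℓ) hk
  have hγ : 0 < min 8 (B1.aSeq a ((ℓ : ℝ) + 1) k) + m2 := add_pos_of_pos_of_nonneg (lt_min (by norm_num) hak) hm
  obtain ⟨-, h2, h3⟩ := GkLat_apply_finsupp hℓ hk ha hm S' hS'
  have hφ2 : Summable fun z => ‖φ z‖ ^ 2 :=
    summable_of_ne_finset_zero (s := S) fun z hz => by rw [hφ z hz, norm_zero, zero_pow two_ne_zero]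
  exact opD_injective_l2_of_pos ((ℓ + 1) ^ k) hak.le hm hγ h2 hφ2 fun x => h3 x

/-! ## §3 Non-vacuity: the hypotheses are met (`d + 1 = 4`, `L = 2`, window `a ∈ [1/2, 2]`, `m² ∈ [0, 1]`) -/

/-- (2.17), `q = p`, at the physical dimension `d + 1 = 4`, `L = 2`. -/
example : ∃ c₀ : ℝ, 0 < c₀ ∧ ∀ (k : ℕ), 1 ≤ k → ∀ (a m2 : ℝ), (1 / 2 : ℝ) ≤ a → a ≤ 2 → 0 ≤ m2 → m2 ≤ 1 →
      ∀ (p : ℝ), 1 ≤ p → ∀ (S Λ : Finset (Fin (3 + 1) → ℤ)) (f : (Fin (3 + 1) → ℤ) → ℂ),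
        (∑ x ∈ Λ, ‖∑ x' ∈ S, ((GkLat 1 k a m2 x x' : ℝ) : ℂ) * f x'‖ ^ p) ^ p⁻¹
          ≤ c₀ * (∑ x' ∈ S, ‖f x'‖ ^ p) ^ p⁻¹ :=
  GkLat_apply_lp_le 3 1 le_rfl (1 / 2) 2 1 (by norm_num)

/-- the quantifier prefix is inhabited (`k = 1`, `a = 1`, `m² = 0`, `p = 2`, a bounded datum). -/
example : (1 : ℕ) ≤ 1 ∧ (1 / 2 : ℝ) ≤ 1 ∧ (1 : ℝ) ≤ 2 ∧ (0 : ℝ) ≤ 0 ∧ (0 : ℝ) ≤ 1 ∧ (1 : ℝ) ≤ 2 ∧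
    (∀ z : Fin (3 + 1) → ℤ, ‖(fun _ => (1 : ℂ)) z‖ ≤ 1) :=
  ⟨le_rfl, by norm_num, by norm_num, le_rfl, by norm_num, by norm_num, fun _ => by simp⟩

end

end Literature.MathematicalPhysics.QuantumFieldTheory.Balaban1983to89.B4Lemma22ZeroLattice
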